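import Literature.MathematicalPhysics.QuantumFieldTheory.Dimock2011to13.QED3SingleScaleTheorem1Torus
import Literature.MathematicalPhysics.QuantumFieldTheory.Dimock2011to13.QED3CommutatorBounds
import HarnessLib

/-!
# Dimock, *QED on the 3-torus. II*, §3.2 THEOREM 1 proof PART II (143)–(151) ON THE DISCRETE TORUS for `h_□ :=` the
# periodized (124): the later-link bound (143) `|(R_□(A)S*_□(A))(x,y)| ≤ O(L^{k−i}∕M₀)d′(x,y)^{−2}e^{−O(1)d_Λ(x,y)}`
# DERIVED from LEMMA 2 (137) and the printed kernel shapes (144) ∕ (147)–(149) of `A = D + QᵀbQ + (diagonal)`; then THEOREM 1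
# (135), single scale on the torus, FROM LEMMA 2 (136)–(137) ALONE (`dimock_thm1_torus_lemma2`)

statement-level skeleton of published theorems with citation tags; proofs where landed; nothing here is a claim about the Yang–Mills mass gap

**Citation header (reproduction of PUBLISHED work).** J. Dimock, *Quantum electrodynamics on the 3-torus. II. The
renormalization group flow*, arXiv:math-ph/0407063 (2004) [Dimock2004QED3TorusII], §3.2 proof of THEOREM 1, **PART II**
(143)–(151) p.23 L59 – p.24 L58, with §3.1 (124)–(126) p.20 L82 – p.21 L15, LEMMA 1 (129) p.21 L36–39, LEMMA 2
(136)–(137) p.22 L32–47, THEOREM 1 (135) p.22 L12–21 and Remark 3 p.22 L28–30, of the held arXiv text layer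
`paper:arxiv-math-ph_0407063` (`p.NN Lnn` = PDF page ∕ text-layer line).  Writer seat p11
(literature-prover-lit-balaban-p11-g24-0), YM LIT SWEEP item (c) D13 (row C13 «WHERE»; zero weight for the YM-INPRINT
tokens).  Imports the tree's `QED3SingleScaleTheorem1Torus` (THEOREM 1 single scale on the torus with `h_□ := (124)`
periodized: `dimock_thm1_torus_printed`, whose hypothesis `hR'` is (143); `card_filter_mem_tball_le`; through it
`QED3TorusPartitionOfUnity.abs_sub_g_torus_le` = (145) ∕ (150) on the torus, `QED3BlockPotentialSumsTorus.eq129_torus` =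
«we use (129)» on the torus, `QED3WalkLocality.linkR_apply` ∕ `link0_apply`, `RegionVolume` = sup-balls `tball` and the
block map `czmap`, `RandomWalkTorusDecay.torusDist`) and `QED3CommutatorBounds` (the abstract Part II: `profile_hop_le`).

**The printed text** (p.23 L59–69, p.24 L29–58).  *"Part II. To estimate this expansion we need the following bound.
For `□ ∈ D_i` `|(R_□(A)S*_□(A))(x,y)| ≤ O(L^{k−i}∕M₀)d′(x,y)^{−2}exp(−O(1)d_Λ(x,y))` (143) To prove it we write
`R_□ = R^D_□ + R^Q_□` where `R^D_□ = −[D_{e_k},h_□]` and `R^Q_□ = −[Qᵀ_{k,Λ}bQ_{k,Λ},h_□]`. We have explicitly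
`(R^D_□(A)S*_□(A))(x,y) = Σ_{x′}γ_{x,x′}L^ke^{ie_kL^{−k}A(x,x′)}(h_□(x) − h_□(x′))S*_□(x′,y)` (144) where the sum is over
nearest neighbors `x′` of `x`. The result now follows by `L^k|h_□(x) − h_□(x′)| ≤ sup_x|∂h_□(x)| ≤ O(L^{k−i}∕M₀)` (145)
and (137) and `d′(x′,y) ≥ d′(x,y)∕2` and `d_Λ(x′,y) ≥ d_Λ(x,y) − 1`. … `(Q^{(k)}_i(−A)ᵀb_iQ^{(k)}_i(A))(x,x′) =
L^{2(k−i)}b_i exp(ie_iA_{L^{k−i}}(…))χ(|x′ − [x]| ≤ L^{−(k−i)}∕2)` (147) … Then `(R^Q_□(A)S*_□(A))(x,y) =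
b_i∫_{|x′−[x]|≤L^{−(k−i)}∕2}L^{2(k−i)}exp(ie_iA_{L^{k−i}}(…))(h_□(x) − h_□(x′))S*_□(x′,y)` (149) Now since `|x − x′| ≤
L^{−(k−i)}` `|h_□(x) − h_□(x′)| ≤ L^{−(k−i)}sup_x|∂h_□(x)| ≤ O(M₀^{−1})` (150) we obtain `|(R^Q_□(A)S*_□(A))(x,y)| ≤
O(L^{2(k−i)}∕M₀)∫_{|x′−[x]|≤L^{−(k−i)}∕2}d′(x′,y)^{−2}exp(−O(1)d_Λ(x,y)) ≤ O(L^{k−i}∕M₀)exp(−O(1)d_Λ(x,y))` (151) In the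
second step we use (129). Since `d′(x,y) ≤ d_Λ(x,y) + 1` the result follows."*

**What is formalized (kernel-checked, zero `sorry`, no named facts).**  The setting is that of
`dimock_thm1_torus_printed`: sites `X` embedded injectively by `e` in the site torus `(ℤ∕N_s)³` (spacing `η`), unit
blocks `Δ_x = czmap ℓ_b N_b (e x)` of `ℓ_b` sites (`N_s = ℓ_bN_b`, `≤ R³` sites of `X` per block), cubes of `M₀` blocks
(`ℓ = ℓ_bM₀`), the multiplication operators `h_w(x) = g(ℓ^{−1}·valMinAbs(e x − cz w) − t)` (the periodized (124)), the
entries of `S*_□ = G w` bounded by LEMMA 2 (137) in the printed currency `C₀·η³d′_T(e u,e v)^{−2}e^{−c·d(Δ_u,Δ_v)}`, and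
`A` with off-diagonal entries `A(x,u) = A_D(x,u) + A_Q(x,u)` where `A_D(x,u) ≠ 0 ⟹ e u ∈ (e x)^{∼1}` (nearest neighbours,
(144): `‖A_D‖ ≤ a_D`, the printed `γ_{x,x′}L^ke^{i…}`: `a_D = ‖γ‖L^k`) and `A_Q(x,u) ≠ 0 ⟹ Δ_u = Δ_x` (the block average
(147): `‖A_Q‖ ≤ a_Q`, the printed `b_iL^{2(k−i)}e^{i…}χ` against `∫dx′ = Ση³`: `a_Q = bL^{2(k−i)}η³`); the diagonal of `A`
(mass term, diagonal of `D`) is free — it commutes with `h_□`.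
* §1 torus geometry of the hops — `torusDist_le_of_mem_tball` (`d(b,b′) ≤ 3s` on a sup-ball of radius `s`: *"`d_Λ(x′,y) ≥
  d_Λ(x,y) − 1`"* at block level), `supN_vmaVec_sub_le_of_mem_tball` ∕ `dOne_vmaVec_sub_le_of_mem_tball` (the minimal lift
  of `x − x′` for `x′ ∈ x^{∼s}` has sup-norm `≤ s`: *"`d′(x′,y) ≥ d′(x,y)∕2`"* for neighbours), `rpow_neg_two_le_four_mul`.
* §2 **«we use (129)» on the torus WITHOUT LOSING DECAY** — `sum_block_dprimeT_le`:
  `Σ_{u : Δ_u = Δ_x}η³d′_T(e u,e v)^{−2} ≤ κ·d′_T(e x,e v)^{−2}`, `κ = 4(ηR)³ + 4C(2)(ηR)(ηℓ_b)²`, by the two cases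
  `d′_T(e x,e v) ≥ 2ηℓ_b` (then `d′_T(e u,e v) ≥ d′_T(e x,e v)∕2` on the block: comparability) and `d′_T(e x,e v) < 2ηℓ_b`
  (then LEMMA 1 (129) on the torus, `eq129_torus` at `α = 2`, and `1 ≤ (2ηℓ_b)²d′^{−2}`).
* §3 **PART II on the torus** — `Kz_apply_algebraMap` (`R_□(x,u) = (h_□(x) − h_□(u))·A(x,u)` for central `h_□`),
  `norm_linkR_le_sum` (`‖(R_□S*_□h_□)(x,v)‖ ≤ Σ_u|h_□(x) − h_□(u)|·‖A(x,u)‖·‖S*_□(u,v)‖`), `norm_link0_le`;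
  **`sum_nn_part_le`** = (144) ⟹ (143) for the nearest-neighbour part ((145) on the torus with `s = 1`:
  `|h_□(x) − h_□(x′)| ≤ G∕ℓ`; `d′_T(e x′,e v) ≥ d′_T(e x,e v)∕2`; `d(Δ_{x′},Δ_v) ≥ d(Δ_x,Δ_v) − 6`; at most `27` neighbours):
  `≤ 27·(G∕ℓ)·a_D·4e^{6c}·C₀·η³d′_T^{−2}e^{−cd}`; **`sum_avg_part_le`** = (149) ⟹ (151) ⟹ (143) for the averaging part
  ((150) on the torus with `s = ℓ_b − 1`: `|h_□(x) − h_□(x′)| ≤ G(ℓ_b − 1)∕ℓ ≤ G∕M₀`; same block ⟹ same `d(Δ_·,Δ_v)`;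
  §2): `≤ (Gℓ_b∕ℓ)·a_Q·C₀·κ·d′_T^{−2}e^{−cd}`; **`eq143_torus`**: (143) on the torus,
  `‖(R_□S*_□h_□)(x,v)‖ ≤ C₁∕M₀ · η³d′_T(e x,e v)^{−2}e^{−c·d(Δ_x,Δ_v)}`, `C₁ = GC₀(108e^{6c}a_D∕ℓ_b + a_Qκ∕η³)` — with
  the printed sizes (`ℓ_b = L^i` sites, `η = L^{−k}`, `a_D = ‖γ‖L^k`, `a_Q = bL^{2(k−i)}η³`, `R = ℓ_b`) this is
  `O(L^{k−i}∕M₀)` as printed (the `a_Q` part is even `O(L^{−(k−i)}∕M₀)`).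
* §4 **`dimock_thm1_torus_lemma2`** — THEOREM 1 (135), single scale, on the 3-torus, with `h_□ :=` the periodized (124),
  FROM LEMMA 2 ALONE: hypotheses (136) `h_□AS*_□ = h_□`, (137) on the entries of `S*_□`, the kernel shapes of `A`, and the
  explicit size ∕ largeness arithmetic (*"`M_0` sufficiently large"*); (125), (143), (154), the supports, the range of `A`
  and the adjacency are all DERIVED (this file, `QED3SingleScaleTheorem1Torus`, `QED3TorusPartitionOfUnity`,
  `QED3BlockPotentialSumsTorus`).  Conclusion: the walk expansion converges entrywise, `A·S_k(A) = 1`, and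
  `‖S_k(A;x,y)‖ ≤ 2·3³·C₀·η³d′_T(e x,e y)^{−2}e^{−(c∕2)d(Δ_x,Δ_y)}`.  **`dimock_thm1_torus_uniform`**: with UNIT blocks
  (`ηℓ_b = 1`, `R = ℓ_b`) and the printed kernel sizes `a_D = γ₀η^{−1}`, `a_Q = bη³` the constants collapse to
  `C₁ = GC₀(108e^{6c}γ₀ + 4b(1 + C(2)))`, `θ = 8C(2)` — independent of the scale `k` and of the volume: ONE explicit
  `M₀` (*"`M_0` sufficiently large"*, Remark 3 «the same bound holds on the unit lattice … also on a torus»);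
  **`dimock_thm1_torus_uniform'`** (v1.1): the same with the bookkeeping DISCHARGED — bump centred at the cube corners
  (`t = τ = 0`), support radius `r = ℓ_b(M₀ − 4)`, `N_c ≥ 2`: the eight size conditions follow from `M₀ ≥ 12`, leaving
  `M₀ ≥ 12`, `2·3³·C₁·8C(2)·K₁(3,c∕2) ≤ M₀`, (136), (137) and the kernel shapes as the ONLY hypotheses;
  **`dimock_thm1_path_torus_lemma2`** (v1.2): **(134) FOR EVERY PATH** on the 3-torus from LEMMA 2 alone —
  `‖S_{k,Λ,ω}(A;x,y)‖ ≤ C₀(C₁·2³C(2)(ηR)·K₁(3,c∕2)∕M₀)^{|ω|}·η³d′_T(e x,e y)^{−2}e^{−(c∕2)d(Δ_x,Δ_y)}`, the printed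
  `O(1)(O(1)M_0^{−1})^{|ω|}` explicit, no largeness needed (`norm_chainProd_apply_le` with the torus geometry).

**Readings (declared).**  (i) As in `QED3CommutatorBounds`: the KERNEL SHAPES (144), (147) of `D_{e_k}(A)` and
`Q_kᵀbQ_k(A)` are the starting point (support + sup bound of the entries; phases of modulus one absorbed in `a_D`, `a_Q`);
their derivation from (5), (37) is not formalized.  (ii) The decay currency is the block-level periodic ℓ¹ distance
`d(Δ_u,Δ_v)` of `QED3SingleScaleTheorem1Torus` (reading (i) there); *"`d_Λ(x′,y) ≥ d_Λ(x,y) − 1`"* becomes `− 6` (ℓ¹ in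
`d = 3`, neighbouring blocks within sup-distance `2`), absorbed in `e^{6c}`.  (iii) (151)'s last step (*"we use (129).
Since `d′(x,y) ≤ d_Λ(x,y) + 1` the result follows"*, which re-inserts `d′^{−2}` at the cost of decay rate) is replaced by
the two-case block comparison of §2, which keeps the rate `c` of (137); the constants differ from the printed `O(1)`'s,
the shape (143) is the printed one.  (iv) The window hypothesis `ℓ(|t| + 3∕5) + ℓ_b < N_s∕2` (the support of `h_□` plus
one block stays clear of the antipode) is automatic for the paper's tori (`N_c ≥ 3` cubes per direction); it is what
the torus Lipschitz lemma `abs_sub_g_torus_le` needs.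

**Honest scope.**  HYPOTHESES, in printed shape: LEMMA 2 (136) and (137) (the local inverses `S*_□` and their bounds
are not constructed here: Parts IV–V of the paper, cf. the tree's `QED3BackgroundFieldSeries`), the kernel shapes of
`A`, `E` a complete normed `ℝ`-algebra with `‖1‖ = 1`, and the size conditions.  Single scale only (Remark 3: full
torus, `d_Λ = d`); the multiscale THEOREM 1 (regions `δΛ_i`, (127), (148)'s case distinction) is NOT touched.  No
`d = 4` statement; nothing about Bałaban's papers beyond the reuse of the cell's torus carrier as geometry.

**Version.**  v1.1 — ADDITIVE to v1 (p357351): + `dimock_thm1_torus_uniform'` (§4); every v1 declaration byte-identical.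
v1.2 — ADDITIVE to v1.1 (p357940, commit 08e514a439b1): + `dimock_thm1_path_torus_lemma2` (§4, (134) per path); every
v1.1 declaration byte-identical.
-/

noncomputable section

namespace Literature.MathematicalPhysics.QuantumFieldTheory.Dimock2011to13

namespace QED3TorusII

open Finset Real
open RandomWalkExpansion (Kz Gstar Kop)
open Balaban1983to89.B13ScaleTransfer (Pt)
open Balaban1983to89.TreeLengthTorus (TPt proj natLift proj_natLift)
open Balaban1983to89.B12Decay510Window (K₁)
open Balaban1983to89.B12Decay510Torus (vmaVec pl1 pl1_eq_sum pabs pabs_eq_natAbs pabs_le_abs_of_cast_eq)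
open RandomWalkTorusDecay (torusDist torusDist_nonneg torusDist_triangle)
open RegionVolume (box mem_box tball mem_tball tball_mono self_mem_tball card_tball_le czmap czmap_mem_tball
  mem_tball_of_czmap_eq)
open QED3SquarePartition (g g_nonneg g_le_one)

/-! ## §1 Torus geometry of the hops -/

section Geometry

variable {dd N : ℕ} [NeZero N]

/-- **«`d_Λ(x′,y) ≥ d_Λ(x,y) − 1`» at block level**: a block `b′` in the sup-ball of radius `s` around `b` is at periodic
ℓ¹ distance `≤ d·s` (each coordinate of the minimal lift of `b − b′` is at most `s` in absolute value).
[cite: Dimock2004QED3TorusII, §3.2 Thm 1 proof Part II p.23 L68–69] -/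
theorem torusDist_le_of_mem_tball {b b' : TPt dd N} {s : ℕ} (h : b' ∈ tball b s) :
    torusDist b b' ≤ dd * s := by
  obtain ⟨v, hv, rfl⟩ := mem_tball.1 h
  unfold torusDist
  rw [pl1_eq_sum]
  have hterm : ∀ i, (pabs ((b - (b + proj N v)) i) : ℝ) ≤ s := by
    intro i
    have hcast : (((-v i : ℤ)) : ZMod N) = (b - (b + proj N v)) i := by
      simp only [Pi.sub_apply, Pi.add_apply, proj, Int.cast_neg]
      abel
    have h1 := pabs_le_abs_of_cast_eq hcast
    have h2 : |(-v i : ℤ)| ≤ s := by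
      rw [abs_neg, abs_le]
      exact mem_box.1 hv i
    exact_mod_cast h1.trans h2
  calc ∑ i, (pabs ((b - (b + proj N v)) i) : ℝ) ≤ ∑ _i : Fin dd, (s : ℝ) := sum_le_sum fun i _ => hterm i
    _ = dd * s := by rw [sum_const, card_univ, Fintype.card_fin, nsmul_eq_mul]

/-- **«`d′(x′,y) ≥ d′(x,y)∕2`», the lattice input**: for `x′ ∈ x^{∼s}` on the site torus the minimal lift of `x − x′` has
sup-norm `≤ s` (every integer representative dominates the minimal one). [cite: Dimock2004QED3TorusII, §3.2 Thm 1 proof Part II p.23 L68 and §3.1 (128) p.21 L24–28] -/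
theorem supN_vmaVec_sub_le_of_mem_tball {x x' : TPt 3 N} {s : ℕ} (h : x' ∈ tball x s) :
    supN (vmaVec (x - x')) ≤ s := by
  obtain ⟨v, hv, rfl⟩ := mem_tball.1 h
  unfold supN
  refine Finset.sup_le fun j _ => ?_
  have hcast : (((-v j : ℤ)) : ZMod N) = (x - (x + proj N v)) j := by
    simp only [Pi.sub_apply, Pi.add_apply, proj, Int.cast_neg]
    abel
  have h1 := pabs_le_abs_of_cast_eq hcast
  rw [pabs_eq_natAbs, abs_neg] at h1
  have h2 : |v j| ≤ s := abs_le.2 (mem_box.1 hv j)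
  have h3 : (((x - (x + proj N v)) j).valMinAbs.natAbs : ℤ) ≤ s := h1.trans h2
  show ((x - (x + proj N v)) j).valMinAbs.natAbs ≤ s
  exact_mod_cast h3

/-- the same in the `d′` currency: `dOne(valMinAbs(x − x′)) ≤ s` for `x′ ∈ x^{∼s}`, `s ≥ 1`.
[cite: Dimock2004QED3TorusII, §3.1 (128) p.21 L24–28 and §3.2 Thm 1 proof Part II p.23 L68, p.24 L38] -/
theorem dOne_vmaVec_sub_le_of_mem_tball {x x' : TPt 3 N} {s : ℕ} (h : x' ∈ tball x s) (hs : 1 ≤ s) :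
    dOne (vmaVec (x - x')) ≤ s := by
  have h1 : (supN (vmaVec (x - x')) : ℝ) ≤ s := by exact_mod_cast supN_vmaVec_sub_le_of_mem_tball h
  have h2 : (1 : ℝ) ≤ s := by exact_mod_cast hs
  unfold dOne
  exact max_le h2 h1

/-- **«`d′(x′,y) ≥ d′(x,y)∕2`» ⟹ `d′(x′,y)^{−2} ≤ 4d′(x,y)^{−2}`** (real powers). [cite: Dimock2004QED3TorusII, §3.2 Thm 1 proof Part II p.23 L68] -/
theorem rpow_neg_two_le_four_mul {a b : ℝ} (ha : 0 < a) (hb : 0 < b) (hab : b ≤ 2 * a) :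
    a ^ (-(2 : ℝ)) ≤ 4 * b ^ (-(2 : ℝ)) := by
  rw [Real.rpow_neg ha.le, Real.rpow_neg hb.le, Real.rpow_two, Real.rpow_two, ← div_eq_mul_inv,
    le_div_iff₀ (pow_pos hb 2), inv_mul_le_iff₀ (pow_pos ha 2)]
  nlinarith [mul_le_mul_of_nonneg_left hab hb.le, mul_le_mul_of_nonneg_left hab (by linarith : (0 : ℝ) ≤ 2 * a)]

end Geometry

/-! ## §2 «we use (129)» on the torus, without losing decay: the block sum of `d′^{−2}` against `d′(x,v)^{−2}` -/

section BlockSum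

variable {X : Type*} [Fintype X] {Ns Nb ℓb : ℕ} [NeZero Ns] [NeZero Nb] [NeZero ℓb]

omit [NeZero Nb] in
/-- **The block integral of (151) compared with `d′(x,v)^{−2}`**: for the unit block `Δ_x` (the sites `u` with
`Δ_u = Δ_x`, `≤ R³` of them, `ℓ_b` torus sites per side) and any `v`,
`Σ_{u : Δ_u = Δ_x}η³d′_T(e u,e v)^{−2} ≤ (4(ηR)³ + 4C(2)(ηR)(ηℓ_b)²)·d′_T(e x,e v)^{−2}`.  Two cases: if `d′_T(e x,e v) ≥ 2ηℓ_b`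
then `d′_T(e u,e v) ≥ d′_T(e x,e v)∕2` termwise (`d′_T(e x,e u) ≤ ηℓ_b` inside a block, (128)); otherwise LEMMA 1 (129) on
the torus (`eq129_torus`, `α = 2`: `≤ C(2)(ηR)`) and `1 ≤ (2ηℓ_b)²d′_T(e x,e v)^{−2}`.
[cite: Dimock2004QED3TorusII, §3.2 Thm 1 proof Part II (151) p.24 L43–58 («In the second step we use (129)») and §3.1 Lemma 1 (129) p.21 L36–39] -/
theorem sum_block_dprimeT_le (hmodS : Ns = ℓb * Nb) (e : X → TPt 3 Ns) (he : Function.Injective e)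
    (β : X → TPt 3 Nb) (hβ : ∀ x, β x = czmap ℓb Nb (e x)) {η : ℝ} (hη : 0 < η) {R : ℕ} (hR : 1 ≤ R)
    (hblk : ∀ b, (univ.filter fun u => β u = b).card ≤ R ^ 3) (x v : X) :
    ∑ u ∈ univ.filter (fun u => β u = β x), η ^ 3 * (η * dOne (vmaVec (e u - e v))) ^ (-(2 : ℝ))
      ≤ (4 * (η * R) ^ 3 + 4 * blockConst 2 * (η * R) * (η * ℓb) ^ 2)
          * (η * dOne (vmaVec (e x - e v))) ^ (-(2 : ℝ)) := by
  set F : Finset X := univ.filter fun u => β u = β x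
  have hℓb : 0 < ℓb := Nat.pos_of_ne_zero (NeZero.ne ℓb)
  have hℓbr : (1 : ℝ) ≤ ℓb := by exact_mod_cast hℓb
  have hdxv := dprimeT_pos hη (e x) (e v)
  have hd1 : 0 < dOne (vmaVec (e x - e v)) := dOne_pos _
  have hC2 : 0 ≤ blockConst 2 := zero_le_one.trans (one_le_blockConst (α := 2) (by norm_num))
  have hA : 0 ≤ 4 * (η * R) ^ 3 * (η * dOne (vmaVec (e x - e v))) ^ (-(2 : ℝ)) := by positivity
  have hB : 0 ≤ 4 * blockConst 2 * (η * R) * (η * ℓb) ^ 2 * (η * dOne (vmaVec (e x - e v))) ^ (-(2 : ℝ)) := by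
    positivity
  have hcardF : (F.card : ℝ) ≤ (R : ℝ) ^ 3 := by exact_mod_cast hblk (β x)
  by_cases hcase : 2 * (η * ℓb) ≤ η * dOne (vmaVec (e x - e v))
  · -- far: termwise comparability on the block
    have hterm : ∀ u ∈ F, η ^ 3 * (η * dOne (vmaVec (e u - e v))) ^ (-(2 : ℝ))
        ≤ η ^ 3 * (4 * (η * dOne (vmaVec (e x - e v))) ^ (-(2 : ℝ))) := by
      intro u hu
      have hux : β u = β x := (mem_filter.1 hu).2
      have hmem : e u ∈ tball (e x) (ℓb - 1) := by
        refine mem_tball_of_czmap_eq (Ls := ℓb) (Nc := Nb) hmodS ?_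
        rw [← hβ, ← hβ]
        exact hux
      have h1 : dOne (vmaVec (e x - e u)) ≤ ℓb := by
        have hs := supN_vmaVec_sub_le_of_mem_tball hmem
        have hs' : (supN (vmaVec (e x - e u)) : ℝ) ≤ ℓb := by
          have h' : ((ℓb - 1 : ℕ) : ℝ) ≤ ℓb := by exact_mod_cast Nat.sub_le ℓb 1
          exact le_trans (by exact_mod_cast hs) h'
        unfold dOne
        exact max_le hℓbr hs'
      have htri := dprimeT_triangle hη.le (e x) (e u) (e v)
      have h2 : η * dOne (vmaVec (e x - e u)) ≤ η * ℓb := mul_le_mul_of_nonneg_left h1 hη.le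
      refine mul_le_mul_of_nonneg_left ?_ (pow_nonneg hη.le 3)
      exact rpow_neg_two_le_four_mul (dprimeT_pos hη (e u) (e v)) hdxv (by linarith)
    calc ∑ u ∈ F, η ^ 3 * (η * dOne (vmaVec (e u - e v))) ^ (-(2 : ℝ))
        ≤ ∑ u ∈ F, η ^ 3 * (4 * (η * dOne (vmaVec (e x - e v))) ^ (-(2 : ℝ))) := sum_le_sum hterm
      _ = F.card * (η ^ 3 * (4 * (η * dOne (vmaVec (e x - e v))) ^ (-(2 : ℝ)))) := by
          rw [sum_const, nsmul_eq_mul]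
      _ ≤ (R : ℝ) ^ 3 * (η ^ 3 * (4 * (η * dOne (vmaVec (e x - e v))) ^ (-(2 : ℝ)))) :=
          mul_le_mul_of_nonneg_right hcardF (by positivity)
      _ = 4 * (η * R) ^ 3 * (η * dOne (vmaVec (e x - e v))) ^ (-(2 : ℝ)) := by ring
      _ ≤ _ := by rw [add_mul]; linarith
  · -- near: LEMMA 1 (129) on the torus
    rw [not_le] at hcase
    have hinj : ∀ y ∈ F, ∀ y' ∈ F, e y = e y' → y = y' := fun y _ y' _ h => he h
    have hcard : (F.image e).card ≤ R ^ 3 := card_image_le.trans (hblk (β x))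
    have h129 := eq129_torus (α := 2) (by norm_num) (by norm_num) hη (F.image e) hR hcard (e v)
    rw [sum_image hinj, show (3 : ℝ) - 2 = 1 by norm_num, Real.rpow_one] at h129
    have hsum : ∑ u ∈ F, η ^ 3 * (η * dOne (vmaVec (e u - e v))) ^ (-(2 : ℝ))
        = ∑ u ∈ F, η ^ 3 * (η * dOne (vmaVec (e v - e u))) ^ (-(2 : ℝ)) :=
      sum_congr rfl fun u _ => by rw [dOne_vmaVec_sub_comm]
    rw [hsum]
    refine h129.trans ?_
    have hone : (1 : ℝ) ≤ (2 * (η * ℓb)) ^ 2 * (η * dOne (vmaVec (e x - e v))) ^ (-(2 : ℝ)) := by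
      rw [Real.rpow_neg hdxv.le, Real.rpow_two, ← div_eq_mul_inv, le_div_iff₀ (pow_pos hdxv 2), one_mul]
      exact pow_le_pow_left₀ hdxv.le hcase.le 2
    calc blockConst 2 * (η * R) = blockConst 2 * (η * R) * 1 := (mul_one _).symm
      _ ≤ blockConst 2 * (η * R) * ((2 * (η * ℓb)) ^ 2 * (η * dOne (vmaVec (e x - e v))) ^ (-(2 : ℝ))) :=
          mul_le_mul_of_nonneg_left hone (by positivity)
      _ = 4 * blockConst 2 * (η * R) * (η * ℓb) ^ 2 * (η * dOne (vmaVec (e x - e v))) ^ (-(2 : ℝ)) := by ring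
      _ ≤ _ := by rw [add_mul]; linarith

end BlockSum

/-! ## §3 PART II on the torus: (144)–(145) and (149)–(151) ⟹ (143) -/

section PartII

variable {X : Type*} [Fintype X] [DecidableEq X]
variable {E : Type*} [NormedRing E] [NormedAlgebra ℝ E] [NormOneClass E]
variable {Z : Type*}

omit [NormOneClass E] in
/-- **`R_□ = h_□A − Ah_□` entrywise for a CENTRAL multiplication operator**: `R_□(x,u) = (h_□(x) − h_□(u))·A(x,u)` — the
factor `(h_□(x) − h_□(x′))` of (144) and (149). [cite: Dimock2004QED3TorusII, §3.2 Thm 1 proof Part I (140) p.23 L18–25 and Part II (144), (149) p.23 L63 – p.24 L37] -/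
theorem Kz_apply_algebraMap (f : Z → X → ℝ) {H : Z → Matrix X X E}
    (hH : ∀ z, H z = Matrix.diagonal fun x => algebraMap ℝ E (f z x)) (A : Matrix X X E) (z : Z) (x u : X) :
    Kz A H z x u = (f z x - f z u) • A x u := by
  have h := Kz_apply (φ := fun z x => algebraMap ℝ E (f z x)) hH A z x u
  beta_reduce at h
  rw [h, Algebra.smul_def, map_sub, sub_mul, Algebra.commutes (f z u) (A x u)]

/-- **the later link entrywise**: `‖(R_□S*_□h_□)(x,v)‖ ≤ Σ_u|h_□(x) − h_□(u)|·‖A(x,u)‖·‖S*_□(u,v)‖` for central `h_□` with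
`|h_□| ≤ 1` (`‖1‖ = 1` in `E`). [cite: Dimock2004QED3TorusII, §3.2 Thm 1 proof Part I (142) p.23 L31–40 and Part II (144), (149) p.23 L63 – p.24 L37] -/
theorem norm_linkR_le_sum (f : Z → X → ℝ) {H : Z → Matrix X X E}
    (hH : ∀ z, H z = Matrix.diagonal fun x => algebraMap ℝ E (f z x)) (hf1 : ∀ z x, |f z x| ≤ 1)
    (A : Matrix X X E) (G : Z → Matrix X X E) (z : Z) (x v : X) :
    ‖linkR A H G z x v‖ ≤ ∑ u, |f z x - f z u| * ‖A x u‖ * ‖G z u v‖ := by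
  have happ := linkR_apply (φ := fun z x => algebraMap ℝ E (f z x)) hH A G z x v
  beta_reduce at happ
  rw [happ]
  have hφ : ∀ y, ‖algebraMap ℝ E (f z y)‖ ≤ 1 := fun y => by
    rw [norm_algebraMap', Real.norm_eq_abs]
    exact hf1 z y
  have hK : ∀ u, algebraMap ℝ E (f z x) * A x u - A x u * algebraMap ℝ E (f z u) = (f z x - f z u) • A x u := by
    intro u
    rw [Algebra.smul_def, map_sub, sub_mul, Algebra.commutes (f z u) (A x u)]
  simp_rw [hK]
  calc ‖(∑ u, (f z x - f z u) • A x u * G z u v) * algebraMap ℝ E (f z v)‖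
      ≤ ‖∑ u, (f z x - f z u) • A x u * G z u v‖ * ‖algebraMap ℝ E (f z v)‖ := norm_mul_le _ _
    _ ≤ ‖∑ u, (f z x - f z u) • A x u * G z u v‖ * 1 :=
        mul_le_mul_of_nonneg_left (hφ v) (norm_nonneg _)
    _ ≤ ∑ u, ‖(f z x - f z u) • A x u * G z u v‖ := by
        rw [mul_one]
        exact norm_sum_le _ _
    _ ≤ ∑ u, |f z x - f z u| * ‖A x u‖ * ‖G z u v‖ := sum_le_sum fun u _ => by
        refine (norm_mul_le _ _).trans ?_
        rw [norm_smul, Real.norm_eq_abs]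

/-- **the first link against (137)**: `‖(h_□S*_□h_□)(x,v)‖ ≤ ‖S*_□(x,v)‖` for central `h_□` with `|h_□| ≤ 1`.
[cite: Dimock2004QED3TorusII, §3.2 Thm 1 proof Part I (142) p.23 L31–40 and Lemma 2 (137) p.22 L43–45] -/
theorem norm_link0_le (f : Z → X → ℝ) {H : Z → Matrix X X E}
    (hH : ∀ z, H z = Matrix.diagonal fun x => algebraMap ℝ E (f z x)) (hf1 : ∀ z x, |f z x| ≤ 1)
    (G : Z → Matrix X X E) (z : Z) (x v : X) : ‖link0 H G z x v‖ ≤ ‖G z x v‖ := by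
  have happ := link0_apply (φ := fun z x => algebraMap ℝ E (f z x)) hH G z x v
  beta_reduce at happ
  rw [happ]
  have hφ : ∀ y, ‖algebraMap ℝ E (f z y)‖ ≤ 1 := fun y => by
    rw [norm_algebraMap', Real.norm_eq_abs]
    exact hf1 z y
  calc ‖algebraMap ℝ E (f z x) * G z x v * algebraMap ℝ E (f z v)‖
      ≤ ‖algebraMap ℝ E (f z x) * G z x v‖ * ‖algebraMap ℝ E (f z v)‖ := norm_mul_le _ _
    _ ≤ ‖algebraMap ℝ E (f z x)‖ * ‖G z x v‖ * ‖algebraMap ℝ E (f z v)‖ :=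
        mul_le_mul_of_nonneg_right (norm_mul_le _ _) (norm_nonneg _)
    _ ≤ 1 * ‖G z x v‖ * 1 := by
        gcongr
        · exact hφ x
        · exact hφ v
    _ = ‖G z x v‖ := by ring

variable {Ns Nb Nc M₀ ℓb : ℕ} [NeZero Ns] [NeZero Nb] [NeZero Nc] [NeZero M₀] [NeZero ℓb]

omit [DecidableEq X] [NormedAlgebra ℝ E] [NormOneClass E] [NeZero Nc] in
/-- **(144)–(145) ⟹ (143) for the nearest-neighbour part, on the torus.**  With `h_w := ` the periodized (124)
(`ℓ = ℓ_bM₀` sites per cube side), `A_D(x,u) ≠ 0 ⟹ e u ∈ (e x)^{∼1}`, `‖A_D(x,u)‖ ≤ a_D` and (137) for `S*_□ = G_w`: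
`Σ_u|h_w(x) − h_w(u)|‖A_D(x,u)‖‖G_w(u,v)‖ ≤ 27·(G∕ℓ)·a_D·4e^{6c}·C₀·η³d′_T(e x,e v)^{−2}e^{−c·d(Δ_x,Δ_v)}` — (145) on the torus
(`abs_sub_g_torus_le`, `s = 1`), *"`d′(x′,y) ≥ d′(x,y)∕2`"* (`dOne_vmaVec_sub_le_of_mem_tball`, (128)), *"`d_Λ(x′,y) ≥
d_Λ(x,y) − 1`"* (blocks of neighbours are within sup-distance `2`: `czmap_mem_tball`, `torusDist_le_of_mem_tball`), the
tree's `profile_hop_le`, and at most `27` neighbours (`card_filter_mem_tball_le`).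
[cite: Dimock2004QED3TorusII, §3.2 Thm 1 proof Part II (143)–(145) p.23 L59–69] -/
theorem sum_nn_part_le {c η t Gg aD C₀ : ℝ} (hmodS : Ns = ℓb * Nb) (e : X → TPt 3 Ns)
    (he : Function.Injective e) (β : X → TPt 3 Nb) (hβ : ∀ x, β x = czmap ℓb Nb (e x)) (hη : 0 < η) (hc : 0 ≤ c)
    (hGg : ∀ z : Fin 3 → ℝ, ‖fderiv ℝ (g : (Fin 3 → ℝ) → ℝ) z‖ ≤ Gg)
    (hwin : (((ℓb * M₀ : ℕ)) : ℝ) * (|t| + 3 / 5) + 1 < (Ns : ℝ) / 2)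
    (cz : TPt 3 Nc → TPt 3 Ns) (w : TPt 3 Nc)
    (AD : Matrix X X E) (hAD : ∀ x u, AD x u ≠ 0 → e u ∈ tball (e x) 1) (haD : 0 ≤ aD)
    (hADn : ∀ x u, ‖AD x u‖ ≤ aD) (Gw : Matrix X X E) (hC₀ : 0 ≤ C₀)
    (h137 : ∀ u v, ‖Gw u v‖ ≤ C₀ * ((η ^ 3 * (η * dOne (vmaVec (e u - e v))) ^ (-(2 : ℝ)))
      * Real.exp (-(c * torusDist (β u) (β v)))))
    (x v : X) :
    ∑ u, |g (fun i => (((ℓb * M₀ : ℕ) : ℝ))⁻¹ * (((e x - cz w) i).valMinAbs : ℝ) - t)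
          - g (fun i => (((ℓb * M₀ : ℕ) : ℝ))⁻¹ * (((e u - cz w) i).valMinAbs : ℝ) - t)| * ‖AD x u‖ * ‖Gw u v‖
      ≤ 27 * ((Gg * (((ℓb * M₀ : ℕ) : ℝ))⁻¹) * aD * (4 * Real.exp (c * 6) *
          (C₀ * ((η ^ 3 * (η * dOne (vmaVec (e x - e v))) ^ (-(2 : ℝ)))
            * Real.exp (-(c * torusDist (β x) (β v))))))) := by
  haveI : NeZero (ℓb * M₀) := ⟨Nat.mul_ne_zero (NeZero.ne ℓb) (NeZero.ne M₀)⟩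
  set Φ : X → ℝ := fun u => (η ^ 3 * (η * dOne (vmaVec (e u - e v))) ^ (-(2 : ℝ)))
    * Real.exp (-(c * torusDist (β u) (β v)))
  have hGg0 : 0 ≤ Gg := (norm_nonneg _).trans (hGg 0)
  have hΦ0 : ∀ u, 0 ≤ Φ u := fun u =>
    mul_nonneg (mul_nonneg (pow_nonneg hη.le 3) (Real.rpow_nonneg (dprimeT_pos hη (e u) (e v)).le _))
      (Real.exp_pos _).le
  set B : ℝ := (Gg * (((ℓb * M₀ : ℕ) : ℝ))⁻¹) * aD * (4 * Real.exp (c * 6) * (C₀ * Φ x)) with hB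
  have hB0 : 0 ≤ B := by
    have := hΦ0 x
    simp only [hB]
    positivity
  have hterm : ∀ u,
      |g (fun i => (((ℓb * M₀ : ℕ) : ℝ))⁻¹ * (((e x - cz w) i).valMinAbs : ℝ) - t)
          - g (fun i => (((ℓb * M₀ : ℕ) : ℝ))⁻¹ * (((e u - cz w) i).valMinAbs : ℝ) - t)| * ‖AD x u‖ * ‖Gw u v‖
        ≤ if e u ∈ tball (e x) 1 then B else 0 := by
    intro u
    split_ifs with hu
    · -- (145) on the torus
      have hlip := abs_sub_g_torus_le (ℓ := ℓb * M₀) (Nc := Nc) (t := t) hGg (s := 1) (by simpa using hwin) cz w hu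
      -- the blocks of neighbours: `Δ_u ∈ Δ_x^{∼2}`, `d(Δ_x,Δ_u) ≤ 6`
      have hβu : β u ∈ tball (β x) 2 := by
        have h1 := czmap_mem_tball (Ls := ℓb) (Nc := Nb) hmodS hu
        rw [← hβ, ← hβ] at h1
        exact tball_mono (by have := Nat.div_le_self 1 ℓb; omega) h1
      have hdist : torusDist (β x) (β v) - 6 ≤ torusDist (β u) (β v) := by
        have h1 := torusDist_le_of_mem_tball hβu
        have h2 := torusDist_triangle (β x) (β u) (β v)
        norm_num at h1
        linarith
      -- `d′_T(e u,e v)^{−2} ≤ 4d′_T(e x,e v)^{−2}`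
      have hP : η ^ 3 * (η * dOne (vmaVec (e u - e v))) ^ (-(2 : ℝ))
          ≤ 4 * (η ^ 3 * (η * dOne (vmaVec (e x - e v))) ^ (-(2 : ℝ))) := by
        have hd1 : dOne (vmaVec (e x - e u)) ≤ (1 : ℕ) := dOne_vmaVec_sub_le_of_mem_tball hu le_rfl
        rw [Nat.cast_one] at hd1
        have htri := dprimeT_triangle hη.le (e x) (e u) (e v)
        have hone := one_le_dOne (vmaVec (e u - e v))
        have hxu : η * dOne (vmaVec (e x - e u)) ≤ η * 1 := mul_le_mul_of_nonneg_left hd1 hη.le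
        have huv : η * 1 ≤ η * dOne (vmaVec (e u - e v)) := mul_le_mul_of_nonneg_left hone hη.le
        have h4 := rpow_neg_two_le_four_mul (dprimeT_pos hη (e u) (e v)) (dprimeT_pos hη (e x) (e v))
          (by linarith)
        calc η ^ 3 * (η * dOne (vmaVec (e u - e v))) ^ (-(2 : ℝ))
            ≤ η ^ 3 * (4 * (η * dOne (vmaVec (e x - e v))) ^ (-(2 : ℝ))) :=
              mul_le_mul_of_nonneg_left h4 (pow_nonneg hη.le 3)
          _ = _ := by ring
      have hprof := profile_hop_le (P := fun u v => η ^ 3 * (η * dOne (vmaVec (e u - e v))) ^ (-(2 : ℝ)))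
        (d := fun u v => torusDist (β u) (β v)) (c := c) (δ := 6) hc
        (fun u v => mul_nonneg (pow_nonneg hη.le 3) (Real.rpow_nonneg (dprimeT_pos hη (e u) (e v)).le _))
        (x := x) (x' := u) (y := v) hP hdist
      calc |g (fun i => (((ℓb * M₀ : ℕ) : ℝ))⁻¹ * (((e x - cz w) i).valMinAbs : ℝ) - t)
              - g (fun i => (((ℓb * M₀ : ℕ) : ℝ))⁻¹ * (((e u - cz w) i).valMinAbs : ℝ) - t)| * ‖AD x u‖ * ‖Gw u v‖
          ≤ (Gg * ((((ℓb * M₀ : ℕ)) : ℝ)⁻¹ * ((1 : ℕ) : ℝ))) * aD * (C₀ * Φ u) :=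
            mul_le_mul (mul_le_mul hlip (hADn x u) (norm_nonneg _) (by positivity)) (h137 u v)
              (norm_nonneg _) (by positivity)
        _ ≤ (Gg * (((ℓb * M₀ : ℕ) : ℝ))⁻¹) * aD * (C₀ * (4 * Real.exp (c * 6) * Φ x)) := by
            rw [Nat.cast_one, mul_one]
            exact mul_le_mul_of_nonneg_left (mul_le_mul_of_nonneg_left hprof hC₀) (by positivity)
        _ = B := by simp only [hB]; ring
    · have h0 : AD x u = 0 := by
        by_contra h
        exact hu (hAD x u h)
      rw [h0, norm_zero, mul_zero, zero_mul]
  have hcard : ((univ.filter fun u => e u ∈ tball (e x) 1).card : ℝ) ≤ 27 := by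
    have h := card_filter_mem_tball_le e he (e x) 1
    norm_num at h
    exact_mod_cast h
  calc ∑ u, |g (fun i => (((ℓb * M₀ : ℕ) : ℝ))⁻¹ * (((e x - cz w) i).valMinAbs : ℝ) - t)
          - g (fun i => (((ℓb * M₀ : ℕ) : ℝ))⁻¹ * (((e u - cz w) i).valMinAbs : ℝ) - t)| * ‖AD x u‖ * ‖Gw u v‖
      ≤ ∑ u, (if e u ∈ tball (e x) 1 then B else 0) := sum_le_sum fun u _ => hterm u
    _ = (univ.filter fun u => e u ∈ tball (e x) 1).card * B := by
        rw [← sum_filter, sum_const, nsmul_eq_mul]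
    _ ≤ 27 * B := mul_le_mul_of_nonneg_right hcard hB0

omit [DecidableEq X] [NormedAlgebra ℝ E] [NormOneClass E] [NeZero Nb] [NeZero Nc] in
/-- **(149)–(151) ⟹ (143) for the averaging part, on the torus.**  With `h_w := ` the periodized (124), `A_Q(x,u) ≠ 0 ⟹
Δ_u = Δ_x` (the block of (147)), `‖A_Q(x,u)‖ ≤ a_Q` and (137) for `S*_□ = G_w`:
`Σ_u|h_w(x) − h_w(u)|‖A_Q(x,u)‖‖G_w(u,v)‖ ≤ (Gℓ_b∕ℓ)·a_Q·C₀·κ·d′_T(e x,e v)^{−2}e^{−c·d(Δ_x,Δ_v)}` (`Gℓ_b∕ℓ = G∕M₀`) — (150) on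
the torus (`abs_sub_g_torus_le` with `s = ℓ_b − 1 ≤ ℓ_b`: *"since `|x − x′| ≤ L^{−(k−i)}`"*, `mem_tball_of_czmap_eq`), same block ⟹
same `d(Δ_·,Δ_v)`, and §2 for *"we use (129)"* (`κ = 4(ηR)³ + 4C(2)(ηR)(ηℓ_b)²`).
[cite: Dimock2004QED3TorusII, §3.2 Thm 1 proof Part II (146)–(151) p.23 L70 – p.24 L58] -/
theorem sum_avg_part_le {c η t Gg aQ C₀ : ℝ} (hmodS : Ns = ℓb * Nb) (e : X → TPt 3 Ns)
    (he : Function.Injective e) (β : X → TPt 3 Nb) (hβ : ∀ x, β x = czmap ℓb Nb (e x)) (hη : 0 < η)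
    {R : ℕ} (hR : 1 ≤ R) (hblk : ∀ b, (univ.filter fun u => β u = b).card ≤ R ^ 3)
    (hGg : ∀ z : Fin 3 → ℝ, ‖fderiv ℝ (g : (Fin 3 → ℝ) → ℝ) z‖ ≤ Gg)
    (hwin : (((ℓb * M₀ : ℕ)) : ℝ) * (|t| + 3 / 5) + ((ℓb - 1 : ℕ) : ℝ) < (Ns : ℝ) / 2)
    (cz : TPt 3 Nc → TPt 3 Ns) (w : TPt 3 Nc)
    (AQ : Matrix X X E) (hAQ : ∀ x u, AQ x u ≠ 0 → β u = β x) (haQ : 0 ≤ aQ)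
    (hAQn : ∀ x u, ‖AQ x u‖ ≤ aQ) (Gw : Matrix X X E) (hC₀ : 0 ≤ C₀)
    (h137 : ∀ u v, ‖Gw u v‖ ≤ C₀ * ((η ^ 3 * (η * dOne (vmaVec (e u - e v))) ^ (-(2 : ℝ)))
      * Real.exp (-(c * torusDist (β u) (β v)))))
    (x v : X) :
    ∑ u, |g (fun i => (((ℓb * M₀ : ℕ) : ℝ))⁻¹ * (((e x - cz w) i).valMinAbs : ℝ) - t)
          - g (fun i => (((ℓb * M₀ : ℕ) : ℝ))⁻¹ * (((e u - cz w) i).valMinAbs : ℝ) - t)| * ‖AQ x u‖ * ‖Gw u v‖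
      ≤ (Gg * ((((ℓb * M₀ : ℕ)) : ℝ)⁻¹ * (ℓb : ℝ))) * aQ * C₀
          * (4 * (η * R) ^ 3 + 4 * blockConst 2 * (η * R) * (η * ℓb) ^ 2)
          * ((η * dOne (vmaVec (e x - e v))) ^ (-(2 : ℝ)) * Real.exp (-(c * torusDist (β x) (β v)))) := by
  haveI : NeZero (ℓb * M₀) := ⟨Nat.mul_ne_zero (NeZero.ne ℓb) (NeZero.ne M₀)⟩
  have hGg0 : 0 ≤ Gg := (norm_nonneg _).trans (hGg 0)
  have hC2 : 0 ≤ blockConst 2 := zero_le_one.trans (one_le_blockConst (α := 2) (by norm_num))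
  have hd1 : 0 < dOne (vmaVec (e x - e v)) := dOne_pos _
  set F : Finset X := univ.filter fun u => β u = β x
  set K : ℝ := (Gg * ((((ℓb * M₀ : ℕ)) : ℝ)⁻¹ * ((ℓb - 1 : ℕ) : ℝ))) * aQ
    * (C₀ * Real.exp (-(c * torusDist (β x) (β v)))) with hK
  have hK0 : 0 ≤ K := by
    simp only [hK]
    positivity
  have hterm : ∀ u ∈ F,
      |g (fun i => (((ℓb * M₀ : ℕ) : ℝ))⁻¹ * (((e x - cz w) i).valMinAbs : ℝ) - t)
          - g (fun i => (((ℓb * M₀ : ℕ) : ℝ))⁻¹ * (((e u - cz w) i).valMinAbs : ℝ) - t)| * ‖AQ x u‖ * ‖Gw u v‖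
        ≤ K * (η ^ 3 * (η * dOne (vmaVec (e u - e v))) ^ (-(2 : ℝ))) := by
    intro u hu
    have hux : β u = β x := (mem_filter.1 hu).2
    have hmem : e u ∈ tball (e x) (ℓb - 1) := by
      refine mem_tball_of_czmap_eq (Ls := ℓb) (Nc := Nb) hmodS ?_
      rw [← hβ, ← hβ]
      exact hux
    have hlip := abs_sub_g_torus_le (ℓ := ℓb * M₀) (Nc := Nc) (t := t) hGg hwin cz w hmem
    have hG := h137 u v
    rw [hux] at hG
    have hP0 : 0 ≤ η ^ 3 * (η * dOne (vmaVec (e u - e v))) ^ (-(2 : ℝ)) :=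
      mul_nonneg (pow_nonneg hη.le 3) (Real.rpow_nonneg (dprimeT_pos hη (e u) (e v)).le _)
    calc |g (fun i => (((ℓb * M₀ : ℕ) : ℝ))⁻¹ * (((e x - cz w) i).valMinAbs : ℝ) - t)
            - g (fun i => (((ℓb * M₀ : ℕ) : ℝ))⁻¹ * (((e u - cz w) i).valMinAbs : ℝ) - t)| * ‖AQ x u‖ * ‖Gw u v‖
        ≤ (Gg * ((((ℓb * M₀ : ℕ)) : ℝ)⁻¹ * ((ℓb - 1 : ℕ) : ℝ))) * aQ
            * (C₀ * ((η ^ 3 * (η * dOne (vmaVec (e u - e v))) ^ (-(2 : ℝ)))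
              * Real.exp (-(c * torusDist (β x) (β v))))) :=
          mul_le_mul (mul_le_mul hlip (hAQn x u) (norm_nonneg _) (by positivity)) hG (norm_nonneg _)
            (by positivity)
      _ = K * (η ^ 3 * (η * dOne (vmaVec (e u - e v))) ^ (-(2 : ℝ))) := by
          simp only [hK]
          ring
  have hvan : ∀ u ∈ (univ : Finset X),
      |g (fun i => (((ℓb * M₀ : ℕ) : ℝ))⁻¹ * (((e x - cz w) i).valMinAbs : ℝ) - t)
          - g (fun i => (((ℓb * M₀ : ℕ) : ℝ))⁻¹ * (((e u - cz w) i).valMinAbs : ℝ) - t)| * ‖AQ x u‖ * ‖Gw u v‖ ≠ 0 →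
        β u = β x := by
    intro u _ hne
    by_contra hu
    apply hne
    have h0 : AQ x u = 0 := by
      by_contra h
      exact hu (hAQ x u h)
    rw [h0, norm_zero, mul_zero, zero_mul]
  rw [← sum_filter_of_ne hvan]
  have hdx := dprimeT_pos hη (e x) (e v)
  have hle : ((ℓb - 1 : ℕ) : ℝ) ≤ (ℓb : ℝ) := by exact_mod_cast Nat.sub_le ℓb 1
  have hM : 0 ≤ Gg * (((ℓb * M₀ : ℕ) : ℝ))⁻¹ * aQ * C₀
      * (4 * (η * R) ^ 3 + 4 * blockConst 2 * (η * R) * (η * ℓb) ^ 2)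
      * ((η * dOne (vmaVec (e x - e v))) ^ (-(2 : ℝ)) * Real.exp (-(c * torusDist (β x) (β v)))) := by
    positivity
  calc ∑ u ∈ F, |g (fun i => (((ℓb * M₀ : ℕ) : ℝ))⁻¹ * (((e x - cz w) i).valMinAbs : ℝ) - t)
          - g (fun i => (((ℓb * M₀ : ℕ) : ℝ))⁻¹ * (((e u - cz w) i).valMinAbs : ℝ) - t)| * ‖AQ x u‖ * ‖Gw u v‖
      ≤ ∑ u ∈ F, K * (η ^ 3 * (η * dOne (vmaVec (e u - e v))) ^ (-(2 : ℝ))) := sum_le_sum hterm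
    _ = K * ∑ u ∈ F, η ^ 3 * (η * dOne (vmaVec (e u - e v))) ^ (-(2 : ℝ)) := by rw [mul_sum]
    _ ≤ K * ((4 * (η * R) ^ 3 + 4 * blockConst 2 * (η * R) * (η * ℓb) ^ 2)
          * (η * dOne (vmaVec (e x - e v))) ^ (-(2 : ℝ))) :=
        mul_le_mul_of_nonneg_left (sum_block_dprimeT_le hmodS e he β hβ hη hR hblk x v) hK0
    _ = ((ℓb - 1 : ℕ) : ℝ) * (Gg * (((ℓb * M₀ : ℕ) : ℝ))⁻¹ * aQ * C₀
          * (4 * (η * R) ^ 3 + 4 * blockConst 2 * (η * R) * (η * ℓb) ^ 2)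
          * ((η * dOne (vmaVec (e x - e v))) ^ (-(2 : ℝ)) * Real.exp (-(c * torusDist (β x) (β v))))) := by
        simp only [hK]
        ring
    _ ≤ (ℓb : ℝ) * (Gg * (((ℓb * M₀ : ℕ) : ℝ))⁻¹ * aQ * C₀
          * (4 * (η * R) ^ 3 + 4 * blockConst 2 * (η * R) * (η * ℓb) ^ 2)
          * ((η * dOne (vmaVec (e x - e v))) ^ (-(2 : ℝ)) * Real.exp (-(c * torusDist (β x) (β v))))) :=
        mul_le_mul_of_nonneg_right hle hM
    _ = _ := by ring

omit [NeZero Nc] in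
/-- **(143) ON THE TORUS for `h_□ :=` the periodized (124)**: for `A` whose off-diagonal entries split as
`A(x,u) = A_D(x,u) + A_Q(x,u)` (nearest-neighbour part of sup `a_D`, block-average part of sup `a_Q`; the diagonal is free —
it commutes with `h_□`) and local inverses `S*_□ = G_w` obeying LEMMA 2 (137) with constant `C₀` and rate `c`:
`‖(R_□(A)S*_□(A)h_□)(x,v)‖ ≤ C₁∕M₀ · η³d′_T(e x,e v)^{−2}e^{−c·d(Δ_x,Δ_v)}`, `C₁ = GC₀(108e^{6c}a_D∕ℓ_b + a_Qκ∕η³)`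
(`ℓ = ℓ_bM₀`; `sum_nn_part_le` + `sum_avg_part_le`) — the hypothesis `hR'` of `dimock_thm1_torus_printed`, with the SAME
decay rate as (137). [cite: Dimock2004QED3TorusII, §3.2 Thm 1 proof Part II (143)–(151) p.23 L59 – p.24 L58] -/
theorem eq143_torus {c η t Gg aD aQ C₀ : ℝ} (hmodS : Ns = ℓb * Nb) (e : X → TPt 3 Ns)
    (he : Function.Injective e) (β : X → TPt 3 Nb) (hβ : ∀ x, β x = czmap ℓb Nb (e x)) (hη : 0 < η) (hc : 0 ≤ c)
    {R : ℕ} (hR : 1 ≤ R) (hblk : ∀ b, (univ.filter fun u => β u = b).card ≤ R ^ 3)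
    (hGg : ∀ z : Fin 3 → ℝ, ‖fderiv ℝ (g : (Fin 3 → ℝ) → ℝ) z‖ ≤ Gg)
    (hwin : (((ℓb * M₀ : ℕ)) : ℝ) * (|t| + 3 / 5) + ℓb < (Ns : ℝ) / 2)
    (cz : TPt 3 Nc → TPt 3 Ns) (H : TPt 3 Nc → Matrix X X E)
    (hH : ∀ w, H w = Matrix.diagonal fun x =>
      algebraMap ℝ E (g (fun i => (((ℓb * M₀ : ℕ) : ℝ))⁻¹ * (((e x - cz w) i).valMinAbs : ℝ) - t)))
    (A AD AQ : Matrix X X E) (hA : ∀ x u, x ≠ u → A x u = AD x u + AQ x u)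
    (hAD : ∀ x u, AD x u ≠ 0 → e u ∈ tball (e x) 1) (haD : 0 ≤ aD) (hADn : ∀ x u, ‖AD x u‖ ≤ aD)
    (hAQ : ∀ x u, AQ x u ≠ 0 → β u = β x) (haQ : 0 ≤ aQ) (hAQn : ∀ x u, ‖AQ x u‖ ≤ aQ)
    (G : TPt 3 Nc → Matrix X X E) (hC₀ : 0 ≤ C₀)
    (h137 : ∀ w u v, ‖G w u v‖ ≤ C₀ * ((η ^ 3 * (η * dOne (vmaVec (e u - e v))) ^ (-(2 : ℝ)))
      * Real.exp (-(c * torusDist (β u) (β v)))))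
    (w : TPt 3 Nc) (x v : X) :
    ‖linkR A H G w x v‖
      ≤ (Gg * C₀ * (108 * Real.exp (c * 6) * aD / ℓb
            + aQ * (4 * (η * R) ^ 3 + 4 * blockConst 2 * (η * R) * (η * ℓb) ^ 2) / η ^ 3)) / (M₀ : ℝ)
        * ((η ^ 3 * (η * dOne (vmaVec (e x - e v))) ^ (-(2 : ℝ))) * Real.exp (-(c * torusDist (β x) (β v)))) := by
  have hℓb : 0 < ℓb := Nat.pos_of_ne_zero (NeZero.ne ℓb)
  have hM₀ : 0 < M₀ := Nat.pos_of_ne_zero (NeZero.ne M₀)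
  have hℓb0 : (ℓb : ℝ) ≠ 0 := by exact_mod_cast hℓb.ne'
  have hM₀0 : (M₀ : ℝ) ≠ 0 := by exact_mod_cast hM₀.ne'
  have hwin1 : (((ℓb * M₀ : ℕ)) : ℝ) * (|t| + 3 / 5) + 1 < (Ns : ℝ) / 2 := by
    have : (1 : ℝ) ≤ ℓb := by exact_mod_cast hℓb
    linarith
  have hwinb : (((ℓb * M₀ : ℕ)) : ℝ) * (|t| + 3 / 5) + ((ℓb - 1 : ℕ) : ℝ) < (Ns : ℝ) / 2 := by
    have : ((ℓb - 1 : ℕ) : ℝ) ≤ ℓb := by exact_mod_cast Nat.sub_le ℓb 1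
    linarith
  have hf1 : ∀ (w : TPt 3 Nc) (x : X),
      |g (fun i => (((ℓb * M₀ : ℕ) : ℝ))⁻¹ * (((e x - cz w) i).valMinAbs : ℝ) - t)| ≤ 1 :=
    fun w x => abs_le.2 ⟨by linarith [g_nonneg (fun i => (((ℓb * M₀ : ℕ) : ℝ))⁻¹ *
      (((e x - cz w) i).valMinAbs : ℝ) - t)], g_le_one _⟩
  have h1 := norm_linkR_le_sum
    (fun w x => g (fun i => (((ℓb * M₀ : ℕ) : ℝ))⁻¹ * (((e x - cz w) i).valMinAbs : ℝ) - t)) hH hf1 A G w x v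
  have hD := sum_nn_part_le (M₀ := M₀) hmodS e he β hβ hη hc hGg hwin1 cz w AD hAD haD hADn (G w) hC₀ (h137 w) x v
  have hQ := sum_avg_part_le (M₀ := M₀) hmodS e he β hβ hη hR hblk hGg hwinb cz w AQ hAQ haQ hAQn (G w) hC₀
    (h137 w) x v
  -- split `A = A_D + A_Q` off the diagonal (the diagonal term carries the factor `h(x) − h(x) = 0`)
  have hsplit : ∑ u, |g (fun i => (((ℓb * M₀ : ℕ) : ℝ))⁻¹ * (((e x - cz w) i).valMinAbs : ℝ) - t)
        - g (fun i => (((ℓb * M₀ : ℕ) : ℝ))⁻¹ * (((e u - cz w) i).valMinAbs : ℝ) - t)| * ‖A x u‖ * ‖G w u v‖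
      ≤ ∑ u, |g (fun i => (((ℓb * M₀ : ℕ) : ℝ))⁻¹ * (((e x - cz w) i).valMinAbs : ℝ) - t)
          - g (fun i => (((ℓb * M₀ : ℕ) : ℝ))⁻¹ * (((e u - cz w) i).valMinAbs : ℝ) - t)| * ‖AD x u‖ * ‖G w u v‖
        + ∑ u, |g (fun i => (((ℓb * M₀ : ℕ) : ℝ))⁻¹ * (((e x - cz w) i).valMinAbs : ℝ) - t)
          - g (fun i => (((ℓb * M₀ : ℕ) : ℝ))⁻¹ * (((e u - cz w) i).valMinAbs : ℝ) - t)| * ‖AQ x u‖ * ‖G w u v‖ := by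
    rw [← sum_add_distrib]
    refine sum_le_sum fun u _ => ?_
    by_cases hxu : x = u
    · subst hxu
      simp
    · rw [hA x u hxu]
      have habs := abs_nonneg (g (fun i => (((ℓb * M₀ : ℕ) : ℝ))⁻¹ * (((e x - cz w) i).valMinAbs : ℝ) - t)
        - g (fun i => (((ℓb * M₀ : ℕ) : ℝ))⁻¹ * (((e u - cz w) i).valMinAbs : ℝ) - t))
      calc _ ≤ |g (fun i => (((ℓb * M₀ : ℕ) : ℝ))⁻¹ * (((e x - cz w) i).valMinAbs : ℝ) - t)
            - g (fun i => (((ℓb * M₀ : ℕ) : ℝ))⁻¹ * (((e u - cz w) i).valMinAbs : ℝ) - t)|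
              * (‖AD x u‖ + ‖AQ x u‖) * ‖G w u v‖ :=
            mul_le_mul_of_nonneg_right (mul_le_mul_of_nonneg_left (norm_add_le _ _) habs) (norm_nonneg _)
        _ = _ := by ring
  have hℓ : (((ℓb * M₀ : ℕ)) : ℝ) = (ℓb : ℝ) * M₀ := by push_cast; ring
  refine h1.trans (hsplit.trans ((add_le_add hD hQ).trans (le_of_eq ?_)))
  rw [hℓ]
  have hη3 : η ^ 3 ≠ 0 := pow_ne_zero 3 hη.ne'
  field_simp
  ring

end PartII

/-! ## §4 THEOREM 1, single scale, on the 3-torus, FROM LEMMA 2 ALONE -/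

section Theorem1

variable {Nb Nc M₀ : ℕ} [NeZero Nb] [NeZero Nc] [NeZero M₀]
variable {X : Type*} [Fintype X] [DecidableEq X] {E : Type*} [NormedRing E] [NormedAlgebra ℝ E] [NormOneClass E]

/-- **THEOREM 1 (135), single scale, on the 3-torus, with `h_□ :=` the printed (124) periodized, FROM LEMMA 2 ALONE.**
Data as in `dimock_thm1_torus_printed` (site torus `(ℤ∕N_s)³` at spacing `η`, unit blocks of `ℓ_b` sites with `≤ R³` sites
of `X` each, cubes of `M₀` blocks, `N_s = ℓ_bN_b`, `N_b = M₀N_c`, the periodized bump with centre offset `t ≈ τ∕ℓ`);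
the operator `A` with off-diagonal entries `A_D + A_Q` — nearest-neighbour part `A_D` (`‖A_D‖ ≤ a_D`, (144)) and block
averaging part `A_Q` (`A_Q(x,u) ≠ 0 ⟹ Δ_u = Δ_x`, `‖A_Q‖ ≤ a_Q`, (147)); HYPOTHESES = LEMMA 2: (136) `h_□AS*_□ = h_□` and (137)
`‖S*_□(u,v)‖ ≤ C₀η³d′_T(e u,e v)^{−2}e^{−c·d(Δ_u,Δ_v)}`; plus the window ∕ size conditions and *"`M_0` sufficiently large"*:
`2·3³·C₁·(2³C(2)(ηR))·K₁(3,c∕2) ≤ M₀` with the EXPLICIT `C₁ = GC₀(108e^{6c}a_D∕ℓ_b + a_Qκ∕η³)` of `eq143_torus` (`G` any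
bound of `‖g′‖`, `exists_fderiv_g_le`).  DERIVED: (125) (`h125_torus`), the supports and the range of `A` (site range
`ℓ_b`), (143) (`eq143_torus`), (154) (`hconv_shape_torus`), the adjacency and path counts (`dimock_thm1_torus`).  THEN the
walk expansion converges entrywise, `A·S_k(A) = 1`, and (135)
`‖S_k(A;x,y)‖ ≤ 2·3³·C₀·η³d′_T(e x,e y)^{−2}e^{−(c∕2)d(Δ_x,Δ_y)}`.
[cite: Dimock2004QED3TorusII, §3.2 Thm 1 (132)–(135) p.22 L2–21, Remark 3 p.22 L28–30, Lemma 2 (136)–(137) p.22 L32–47, proof Parts I–III p.23 L1 – p.25 L12; §3.1 (124)–(126) p.20 L82 – p.21 L15, Lemma 1 (129)–(130) p.21 L36–42] -/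
theorem dimock_thm1_torus_lemma2 [CompleteSpace E] {c η t Gg aD aQ C₀ : ℝ} {Ns ℓb R r : ℕ} {τ : ℤ} [NeZero Ns]
    [NeZero ℓb]
    (hmod : Nb = M₀ * Nc) (hmodS : Ns = ℓb * Nb) (hNc : 2 * |t| + 6 / 5 < (Nc : ℝ))
    (e : X → TPt 3 Ns) (he : Function.Injective e)
    (β : X → TPt 3 Nb) (hβ : ∀ x, β x = czmap ℓb Nb (e x)) (ctr : TPt 3 Nb → X) (hctr : ∀ b, β (ctr b) = b)
    (hblk : ∀ b, (univ.filter fun u => β u = b).card ≤ R ^ 3) (hR : 1 ≤ R) (hη : 0 < η) (hc : 0 < c)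
    (hGg : ∀ z : Fin 3 → ℝ, ‖fderiv ℝ (g : (Fin 3 → ℝ) → ℝ) z‖ ≤ Gg)
    {cz : TPt 3 Nc → TPt 3 Ns} (hcz : ∀ w, cz w = proj Ns fun i => ((ℓb * M₀ : ℕ) : ℤ) * natLift w i)
    (hτ0 : 0 ≤ τ) (hτℓ : τ < (ℓb * M₀ : ℕ)) (hτ : |((ℓb * M₀ : ℕ) : ℝ) * t - τ| ≤ 1 / 2)
    (hr : (3 / 5 : ℝ) * ((ℓb * M₀ : ℕ) : ℝ) + 1 / 2 ≤ r)
    (hwin : (((ℓb * M₀ : ℕ)) : ℝ) * (|t| + 3 / 5) + ℓb < (Ns : ℝ) / 2)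
    (H : TPt 3 Nc → Matrix X X E)
    (hH : ∀ w, H w = Matrix.diagonal fun x =>
      algebraMap ℝ E (g (fun i => (((ℓb * M₀ : ℕ) : ℝ))⁻¹ * (((e x - cz w) i).valMinAbs : ℝ) - t)))
    (A AD AQ : Matrix X X E) (hA : ∀ x u, x ≠ u → A x u = AD x u + AQ x u)
    (hAD : ∀ x u, AD x u ≠ 0 → e u ∈ tball (e x) 1) (haD : 0 ≤ aD) (hADn : ∀ x u, ‖AD x u‖ ≤ aD)
    (hAQ : ∀ x u, AQ x u ≠ 0 → β u = β x) (haQ : 0 ≤ aQ) (hAQn : ∀ x u, ‖AQ x u‖ ≤ aQ)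
    (hRρ : 2 * (r / ℓb + 1) + 2 < 2 * M₀) (hRρ' : (r / ℓb + 1) + 2 < M₀)
    (G : TPt 3 Nc → Matrix X X E) (h136 : ∀ w, H w * A * G w = H w)
    (hC₀ : 0 ≤ C₀)
    (h137 : ∀ w u v, ‖G w u v‖ ≤ C₀ * ((η ^ 3 * (η * dOne (vmaVec (e u - e v))) ^ (-(2 : ℝ)))
      * Real.exp (-(c * torusDist (β u) (β v)))))
    (hlarge : 2 * (((3 ^ 3 : ℕ) : ℝ) *
        ((Gg * C₀ * (108 * Real.exp (c * 6) * aD / ℓb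
            + aQ * (4 * (η * R) ^ 3 + 4 * blockConst 2 * (η * R) * (η * ℓb) ^ 2) / η ^ 3))
          * (2 ^ ((2 : ℝ) + 1) * blockConst 2 * (η * R) ^ ((3 : ℝ) - 2)) * K₁ 3 (c / 2))) ≤ (M₀ : ℝ)) :
    (∀ x y, Summable fun n => (Gstar H G * Kop A H G ^ n) x y) ∧
    A * walkExpansion A H G = 1 ∧
    ∀ x y, ‖walkExpansion A H G x y‖
      ≤ 2 * ((3 ^ 3 : ℕ) : ℝ) * C₀ * ((η ^ 3 * (η * dOne (vmaVec (e x - e y))) ^ (-(2 : ℝ)))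
          * Real.exp (-(c / 2) * torusDist (β x) (β y))) := by
  have hℓb : 0 < ℓb := Nat.pos_of_ne_zero (NeZero.ne ℓb)
  have hGg0 : 0 ≤ Gg := (norm_nonneg _).trans (hGg 0)
  have hC2 : 0 ≤ blockConst 2 := zero_le_one.trans (one_le_blockConst (α := 2) (by norm_num))
  have hηR : 0 ≤ η * R := mul_nonneg hη.le (Nat.cast_nonneg R)
  -- the constant of (143)
  have hC₁ : 0 ≤ Gg * C₀ * (108 * Real.exp (c * 6) * aD / ℓb
      + aQ * (4 * (η * R) ^ 3 + 4 * blockConst 2 * (η * R) * (η * ℓb) ^ 2) / η ^ 3) := by positivity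
  -- the site range of `A`: one block
  have hArange : ∀ x y, A x y ≠ 0 → e y ∈ tball (e x) ℓb := by
    intro x y hxy
    by_cases hxy' : x = y
    · subst hxy'
      exact self_mem_tball _ _
    · rw [hA x y hxy'] at hxy
      by_cases hD : AD x y = 0
      · rw [hD, zero_add] at hxy
        have h1 := mem_tball_of_czmap_eq (Ls := ℓb) (Nc := Nb) hmodS
          (show czmap ℓb Nb (e y) = czmap ℓb Nb (e x) by rw [← hβ, ← hβ]; exact hAQ x y hxy)
        exact tball_mono (Nat.sub_le ℓb 1) h1
      · exact tball_mono (by omega) (hAD x y hD)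
  -- the first links against (137)
  have hf1 : ∀ (w : TPt 3 Nc) (x : X),
      |g (fun i => (((ℓb * M₀ : ℕ) : ℝ))⁻¹ * (((e x - cz w) i).valMinAbs : ℝ) - t)| ≤ 1 :=
    fun w x => abs_le.2 ⟨by linarith [g_nonneg (fun i => (((ℓb * M₀ : ℕ) : ℝ))⁻¹ *
      (((e x - cz w) i).valMinAbs : ℝ) - t)], g_le_one _⟩
  have h0 : ∀ w u v, ‖link0 H G w u v‖ ≤ C₀ * ((η ^ 3 * (η * dOne (vmaVec (e u - e v))) ^ (-(2 : ℝ)))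
      * Real.exp (-(c * torusDist (β u) (β v)))) := fun w u v =>
    (norm_link0_le (fun w x => g (fun i => (((ℓb * M₀ : ℕ) : ℝ))⁻¹ * (((e x - cz w) i).valMinAbs : ℝ) - t))
      hH hf1 G w u v).trans (h137 w u v)
  -- (143) on the torus
  have hR' := fun w u v => eq143_torus (M₀ := M₀) hmodS e he β hβ hη hc.le hR hblk hGg hwin cz H hH A AD AQ hA
    hAD haD hADn hAQ haQ hAQn G hC₀ h137 w u v
  have hdiv : ℓb / ℓb + 1 = 2 := by rw [Nat.div_self hℓb]
  exact dimock_thm1_torus_printed hmod hmodS hNc e he β hβ ctr hctr hblk hR hη hc hcz hτ0 hτℓ hτ hr H hH A hArange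
    (by rw [hdiv]; exact hRρ) (by rw [hdiv]; exact hRρ') G h136 hC₀ hC₁ h0 hR' hlarge

/-- **THEOREM 1 (135) with ONE `M₀` FOR ALL SCALES AND VOLUMES** — Remark 3 (*"the same bound holds on the unit lattice
… also on a torus"*) made quantitative: in `dimock_thm1_torus_lemma2` take UNIT blocks (`ηℓ_b = 1`: `ℓ_b = L^k` sites of
spacing `η = L^{−k}`, `R = ℓ_b`) and the printed sizes of the kernels, `a_D = γ₀η^{−1}` ((144): `γ_{x,x′}L^k`, `|γ| ≤ γ₀`)
and `a_Q = bη³` ((147) on one scale, `L^{2(k−i)} = 1`, against `∫dx′ = Ση³`).  Then the constant of (143) is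
`C₁ = GC₀(108e^{6c}γ₀ + 4b(1 + C(2)))` and the block constant of (154) is `θ = 8C(2)` — NEITHER DEPENDS ON `k` NOR ON THE
VOLUME — so *"`M_0` sufficiently large"* is the single explicit condition `2·3³·C₁·8C(2)·K₁(3,c∕2) ≤ M₀`; conclusion (135)
as in `dimock_thm1_torus_lemma2`. [cite: Dimock2004QED3TorusII, §3.2 Thm 1 (135) p.22 L12–21, Remark 3 p.22 L28–30, proof Part II (143)–(151) p.23 L59 – p.24 L58, Part III (154)–(155) p.24 L94 – p.25 L12] -/
theorem dimock_thm1_torus_uniform [CompleteSpace E] {c η t Gg γ₀ b C₀ : ℝ} {Ns ℓb r : ℕ} {τ : ℤ} [NeZero Ns]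
    [NeZero ℓb]
    (hmod : Nb = M₀ * Nc) (hmodS : Ns = ℓb * Nb) (hNc : 2 * |t| + 6 / 5 < (Nc : ℝ))
    (e : X → TPt 3 Ns) (he : Function.Injective e)
    (β : X → TPt 3 Nb) (hβ : ∀ x, β x = czmap ℓb Nb (e x)) (ctr : TPt 3 Nb → X) (hctr : ∀ b, β (ctr b) = b)
    (hblk : ∀ b', (univ.filter fun u => β u = b').card ≤ ℓb ^ 3) (hη : 0 < η) (hunit : η * ℓb = 1) (hc : 0 < c)
    (hGg : ∀ z : Fin 3 → ℝ, ‖fderiv ℝ (g : (Fin 3 → ℝ) → ℝ) z‖ ≤ Gg)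
    {cz : TPt 3 Nc → TPt 3 Ns} (hcz : ∀ w, cz w = proj Ns fun i => ((ℓb * M₀ : ℕ) : ℤ) * natLift w i)
    (hτ0 : 0 ≤ τ) (hτℓ : τ < (ℓb * M₀ : ℕ)) (hτ : |((ℓb * M₀ : ℕ) : ℝ) * t - τ| ≤ 1 / 2)
    (hr : (3 / 5 : ℝ) * ((ℓb * M₀ : ℕ) : ℝ) + 1 / 2 ≤ r)
    (hwin : (((ℓb * M₀ : ℕ)) : ℝ) * (|t| + 3 / 5) + ℓb < (Ns : ℝ) / 2)
    (H : TPt 3 Nc → Matrix X X E)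
    (hH : ∀ w, H w = Matrix.diagonal fun x =>
      algebraMap ℝ E (g (fun i => (((ℓb * M₀ : ℕ) : ℝ))⁻¹ * (((e x - cz w) i).valMinAbs : ℝ) - t)))
    (A AD AQ : Matrix X X E) (hA : ∀ x u, x ≠ u → A x u = AD x u + AQ x u)
    (hAD : ∀ x u, AD x u ≠ 0 → e u ∈ tball (e x) 1) (hγ₀ : 0 ≤ γ₀) (hADn : ∀ x u, ‖AD x u‖ ≤ γ₀ * η⁻¹)
    (hAQ : ∀ x u, AQ x u ≠ 0 → β u = β x) (hb : 0 ≤ b) (hAQn : ∀ x u, ‖AQ x u‖ ≤ b * η ^ 3)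
    (hRρ : 2 * (r / ℓb + 1) + 2 < 2 * M₀) (hRρ' : (r / ℓb + 1) + 2 < M₀)
    (G : TPt 3 Nc → Matrix X X E) (h136 : ∀ w, H w * A * G w = H w)
    (hC₀ : 0 ≤ C₀)
    (h137 : ∀ w u v, ‖G w u v‖ ≤ C₀ * ((η ^ 3 * (η * dOne (vmaVec (e u - e v))) ^ (-(2 : ℝ)))
      * Real.exp (-(c * torusDist (β u) (β v)))))
    (hlarge : 2 * (27 * ((Gg * C₀ * (108 * Real.exp (c * 6) * γ₀ + 4 * b * (1 + blockConst 2)))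
        * (8 * blockConst 2) * K₁ 3 (c / 2))) ≤ (M₀ : ℝ)) :
    (∀ x y, Summable fun n => (Gstar H G * Kop A H G ^ n) x y) ∧
    A * walkExpansion A H G = 1 ∧
    ∀ x y, ‖walkExpansion A H G x y‖
      ≤ 2 * ((3 ^ 3 : ℕ) : ℝ) * C₀ * ((η ^ 3 * (η * dOne (vmaVec (e x - e y))) ^ (-(2 : ℝ)))
          * Real.exp (-(c / 2) * torusDist (β x) (β y))) := by
  have hℓb : 0 < ℓb := Nat.pos_of_ne_zero (NeZero.ne ℓb)
  have hR : 1 ≤ ℓb := hℓb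
  have hℓ : (ℓb : ℝ) = η⁻¹ := eq_inv_of_mul_eq_one_right hunit
  have hη0 : η ≠ 0 := hη.ne'
  have h8 : (2 : ℝ) ^ ((2 : ℝ) + 1) = 8 := by
    rw [show (2 : ℝ) + 1 = ((3 : ℕ) : ℝ) by norm_num, Real.rpow_natCast]
    norm_num
  have h1 : (η * (ℓb : ℝ)) ^ ((3 : ℝ) - 2) = 1 := by
    rw [hunit, Real.one_rpow]
  have key : (Gg * C₀ * (108 * Real.exp (c * 6) * (γ₀ * η⁻¹) / ℓb
        + b * η ^ 3 * (4 * (η * ℓb) ^ 3 + 4 * blockConst 2 * (η * ℓb) * (η * ℓb) ^ 2) / η ^ 3))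
      * (2 ^ ((2 : ℝ) + 1) * blockConst 2 * (η * ℓb) ^ ((3 : ℝ) - 2))
      = (Gg * C₀ * (108 * Real.exp (c * 6) * γ₀ + 4 * b * (1 + blockConst 2))) * (8 * blockConst 2) := by
    rw [h8, h1, hunit, hℓ]
    field_simp
  have h27 : ((3 ^ 3 : ℕ) : ℝ) = 27 := by norm_num
  have hlarge' : 2 * (((3 ^ 3 : ℕ) : ℝ) *
      ((Gg * C₀ * (108 * Real.exp (c * 6) * (γ₀ * η⁻¹) / ℓb
          + b * η ^ 3 * (4 * (η * ℓb) ^ 3 + 4 * blockConst 2 * (η * ℓb) * (η * ℓb) ^ 2) / η ^ 3))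
        * (2 ^ ((2 : ℝ) + 1) * blockConst 2 * (η * ℓb) ^ ((3 : ℝ) - 2)) * K₁ 3 (c / 2))) ≤ (M₀ : ℝ) := by
    rw [key, h27]
    exact hlarge
  exact dimock_thm1_torus_lemma2 hmod hmodS hNc e he β hβ ctr hctr hblk hR hη hc hGg hcz hτ0 hτℓ hτ hr hwin H hH
    A AD AQ hA hAD (by positivity) hADn hAQ (by positivity) hAQn hRρ hRρ' G h136 hC₀ h137 hlarge'

/-- **THEOREM 1 (135) on the 3-torus, EVERY SCALE AND VOLUME, with the bookkeeping discharged.**  In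
`dimock_thm1_torus_uniform` centre the periodized bump at the cube corners (`t = 0`, `τ = 0` — a relabelling of the
cubes), take the support radius `r = ℓ_b(M₀ − 4)` sites and at least two cubes per direction; then the eight size
conditions (`hNc`, `hτ0`, `hτℓ`, `hτ`, `hr`, `hRρ`, `hRρ'`, `hwin`) hold as soon as `M₀ ≥ 12`, and THEOREM 1 reads: for
unit blocks on the site torus `(ℤ∕N_s)³`, `N_s = ℓ_bM₀N_c`, `N_c ≥ 2`, any spacing `η = ℓ_b^{−1}`, the periodized (124),
an operator `A` with the kernel shapes (144) ∕ (147) and local inverses obeying LEMMA 2 (136)–(137): IF `M₀ ≥ 12` and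
`2·3³·GC₀(108e^{6c}γ₀ + 4b(1 + C(2)))·8C(2)·K₁(3,c∕2) ≤ M₀` THEN the walk expansion converges, `A·S_k(A) = 1` and (135)
`‖S_k(A;x,y)‖ ≤ 2·3³·C₀·η³d′_T(e x,e y)^{−2}e^{−(c∕2)d(Δ_x,Δ_y)}` — *"`M_0` sufficiently large"*, uniformly in `k` and in the volume.
[cite: Dimock2004QED3TorusII, §3.2 Thm 1 (135) p.22 L12–21, Remark 3 p.22 L28–30, Lemma 2 (136)–(137) p.22 L32–47, proof Parts I–III p.23 L1 – p.25 L12; §3.1 (124)–(126) p.20 L82 – p.21 L15] -/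
theorem dimock_thm1_torus_uniform' [CompleteSpace E] {c η Gg γ₀ b C₀ : ℝ} {Ns ℓb : ℕ} [NeZero Ns] [NeZero ℓb]
    (hmod : Nb = M₀ * Nc) (hmodS : Ns = ℓb * Nb) (hNc : 2 ≤ Nc) (hM₀ : 12 ≤ M₀)
    (e : X → TPt 3 Ns) (he : Function.Injective e)
    (β : X → TPt 3 Nb) (hβ : ∀ x, β x = czmap ℓb Nb (e x)) (ctr : TPt 3 Nb → X) (hctr : ∀ b, β (ctr b) = b)
    (hblk : ∀ b', (univ.filter fun u => β u = b').card ≤ ℓb ^ 3) (hη : 0 < η) (hunit : η * ℓb = 1) (hc : 0 < c)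
    (hGg : ∀ z : Fin 3 → ℝ, ‖fderiv ℝ (g : (Fin 3 → ℝ) → ℝ) z‖ ≤ Gg)
    {cz : TPt 3 Nc → TPt 3 Ns} (hcz : ∀ w, cz w = proj Ns fun i => ((ℓb * M₀ : ℕ) : ℤ) * natLift w i)
    (H : TPt 3 Nc → Matrix X X E)
    (hH : ∀ w, H w = Matrix.diagonal fun x =>
      algebraMap ℝ E (g (fun i => (((ℓb * M₀ : ℕ) : ℝ))⁻¹ * (((e x - cz w) i).valMinAbs : ℝ))))
    (A AD AQ : Matrix X X E) (hA : ∀ x u, x ≠ u → A x u = AD x u + AQ x u)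
    (hAD : ∀ x u, AD x u ≠ 0 → e u ∈ tball (e x) 1) (hγ₀ : 0 ≤ γ₀) (hADn : ∀ x u, ‖AD x u‖ ≤ γ₀ * η⁻¹)
    (hAQ : ∀ x u, AQ x u ≠ 0 → β u = β x) (hb : 0 ≤ b) (hAQn : ∀ x u, ‖AQ x u‖ ≤ b * η ^ 3)
    (G : TPt 3 Nc → Matrix X X E) (h136 : ∀ w, H w * A * G w = H w)
    (hC₀ : 0 ≤ C₀)
    (h137 : ∀ w u v, ‖G w u v‖ ≤ C₀ * ((η ^ 3 * (η * dOne (vmaVec (e u - e v))) ^ (-(2 : ℝ)))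
      * Real.exp (-(c * torusDist (β u) (β v)))))
    (hlarge : 2 * (27 * ((Gg * C₀ * (108 * Real.exp (c * 6) * γ₀ + 4 * b * (1 + blockConst 2)))
        * (8 * blockConst 2) * K₁ 3 (c / 2))) ≤ (M₀ : ℝ)) :
    (∀ x y, Summable fun n => (Gstar H G * Kop A H G ^ n) x y) ∧
    A * walkExpansion A H G = 1 ∧
    ∀ x y, ‖walkExpansion A H G x y‖
      ≤ 2 * ((3 ^ 3 : ℕ) : ℝ) * C₀ * ((η ^ 3 * (η * dOne (vmaVec (e x - e y))) ^ (-(2 : ℝ)))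
          * Real.exp (-(c / 2) * torusDist (β x) (β y))) := by
  have hℓb : 0 < ℓb := Nat.pos_of_ne_zero (NeZero.ne ℓb)
  have hℓbr : (1 : ℝ) ≤ ℓb := by exact_mod_cast hℓb
  have hM₀r : (12 : ℝ) ≤ M₀ := by exact_mod_cast hM₀
  have hNcr : (2 : ℝ) ≤ Nc := by exact_mod_cast hNc
  have hM₀4 : 4 ≤ M₀ := le_trans (by norm_num) hM₀
  have hprod : 12 * (ℓb : ℝ) ≤ (ℓb : ℝ) * M₀ := by nlinarith
  have hprod2 : 2 * ((ℓb : ℝ) * M₀) ≤ (ℓb : ℝ) * M₀ * Nc := by nlinarith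
  have hℓ : (((ℓb * M₀ : ℕ)) : ℝ) = (ℓb : ℝ) * M₀ := by push_cast; ring
  -- the bump centred at the corners: `t = 0`
  have hH' : ∀ w, H w = Matrix.diagonal fun x =>
      algebraMap ℝ E (g (fun i => (((ℓb * M₀ : ℕ) : ℝ))⁻¹ * (((e x - cz w) i).valMinAbs : ℝ) - 0)) := by
    simp_rw [sub_zero]
    exact hH
  have hdiv : ℓb * (M₀ - 4) / ℓb = M₀ - 4 := Nat.mul_div_cancel_left (M₀ - 4) hℓb
  refine dimock_thm1_torus_uniform (t := 0) (τ := 0) (r := ℓb * (M₀ - 4)) hmod hmodS ?_ e he β hβ ctr hctr hblk hη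
    hunit hc hGg hcz le_rfl ?_ ?_ ?_ ?_ H hH' A AD AQ hA hAD hγ₀ hADn hAQ hb hAQn ?_ ?_ G h136 hC₀ h137 hlarge
  · rw [abs_zero, mul_zero, zero_add]
    linarith
  · exact_mod_cast Nat.mul_pos hℓb (by omega : 0 < M₀)
  · rw [mul_zero, Int.cast_zero, sub_zero, abs_zero]
    norm_num
  · rw [hℓ]
    push_cast [Nat.cast_sub hM₀4]
    nlinarith
  · rw [hℓ, abs_zero, zero_add]
    have hNs : (Ns : ℝ) = (ℓb : ℝ) * M₀ * Nc := by rw [hmodS, hmod]; push_cast; ring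
    rw [hNs]
    nlinarith
  · rw [hdiv]
    omega
  · rw [hdiv]
    omega

omit [NeZero Nc] in
/-- **THEOREM 1 (134) FOR EVERY PATH, single scale, on the 3-torus, FROM LEMMA 2 ALONE** (v1.2) — *"We have the bound
for each path `|S_{k,Λ,ω}(A,x,y)| ≤ O(1)(O(1)M_0^{−1})^{|ω|}d′(x,y)^{−2}exp(−O(1)d_Λ(x,y))` (134)"*: for every cube
sequence `ω = (□_0,…,□_n)` (the path operator `S_{k,Λ,ω}(A)` = the tree's `chainProd`; zero unless `ω` is a path),
`‖S_{k,Λ,ω}(A;x,y)‖ ≤ C₀(C₁·2³C(2)(ηR)·K₁(3,c∕2)∕M₀)^{|ω|}·η³d′_T(e x,e y)^{−2}e^{−(c∕2)d(Δ_x,Δ_y)}` with the EXPLICIT `C₁`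
of `eq143_torus` — every `O(1)` of (134) explicit, and NO largeness condition for the single path.  Data and hypotheses
as in `dimock_thm1_torus_lemma2` without (125), (136), the support radii and *"`M_0` sufficiently large"*; by the tree's
`norm_chainProd_apply_le` with the torus geometry (`d := d(Δ_u,Δ_v)`, `r = 0`, `K = K₁(3,c∕2)`), (143) by `eq143_torus`,
(154) by `hconv_shape_torus`, the first links by `norm_link0_le` + (137).
[cite: Dimock2004QED3TorusII, §3.2 Thm 1 (134) p.22 L17–19, Remark 3 p.22 L28–30, Lemma 2 (137) p.22 L43–45, proof Parts II–III (143), (152)–(155) p.23 L59 – p.25 L12] -/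
theorem dimock_thm1_path_torus_lemma2 {c η t Gg aD aQ C₀ : ℝ} {Ns ℓb R : ℕ} [NeZero Ns] [NeZero ℓb]
    (hmodS : Ns = ℓb * Nb)
    (e : X → TPt 3 Ns) (he : Function.Injective e)
    (β : X → TPt 3 Nb) (hβ : ∀ x, β x = czmap ℓb Nb (e x)) (ctr : TPt 3 Nb → X) (hctr : ∀ b, β (ctr b) = b)
    (hblk : ∀ b, (univ.filter fun u => β u = b).card ≤ R ^ 3) (hR : 1 ≤ R) (hη : 0 < η) (hc : 0 < c)
    (hGg : ∀ z : Fin 3 → ℝ, ‖fderiv ℝ (g : (Fin 3 → ℝ) → ℝ) z‖ ≤ Gg)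
    (hwin : (((ℓb * M₀ : ℕ)) : ℝ) * (|t| + 3 / 5) + ℓb < (Ns : ℝ) / 2)
    (cz : TPt 3 Nc → TPt 3 Ns) (H : TPt 3 Nc → Matrix X X E)
    (hH : ∀ w, H w = Matrix.diagonal fun x =>
      algebraMap ℝ E (g (fun i => (((ℓb * M₀ : ℕ) : ℝ))⁻¹ * (((e x - cz w) i).valMinAbs : ℝ) - t)))
    (A AD AQ : Matrix X X E) (hA : ∀ x u, x ≠ u → A x u = AD x u + AQ x u)
    (hAD : ∀ x u, AD x u ≠ 0 → e u ∈ tball (e x) 1) (haD : 0 ≤ aD) (hADn : ∀ x u, ‖AD x u‖ ≤ aD)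
    (hAQ : ∀ x u, AQ x u ≠ 0 → β u = β x) (haQ : 0 ≤ aQ) (hAQn : ∀ x u, ‖AQ x u‖ ≤ aQ)
    (G : TPt 3 Nc → Matrix X X E) (hC₀ : 0 ≤ C₀)
    (h137 : ∀ w u v, ‖G w u v‖ ≤ C₀ * ((η ^ 3 * (η * dOne (vmaVec (e u - e v))) ^ (-(2 : ℝ)))
      * Real.exp (-(c * torusDist (β u) (β v)))))
    {n : ℕ} (ω : Fin (n + 1) → TPt 3 Nc) (x y : X) :
    ‖chainProd A H G ω x y‖
      ≤ C₀ * ((Gg * C₀ * (108 * Real.exp (c * 6) * aD / ℓb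
            + aQ * (4 * (η * R) ^ 3 + 4 * blockConst 2 * (η * R) * (η * ℓb) ^ 2) / η ^ 3))
          * (2 ^ ((2 : ℝ) + 1) * blockConst 2 * (η * R) ^ ((3 : ℝ) - 2)) * K₁ 3 (c / 2) / (M₀ : ℝ)) ^ n
        * ((η ^ 3 * (η * dOne (vmaVec (e x - e y))) ^ (-(2 : ℝ))) * Real.exp (-(c / 2) * torusDist (β x) (β y))) := by
  have hM₀ : 0 < M₀ := Nat.pos_of_ne_zero (NeZero.ne M₀)
  have hM₀r : (0 : ℝ) < M₀ := by exact_mod_cast hM₀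
  have hGg0 : 0 ≤ Gg := (norm_nonneg _).trans (hGg 0)
  have hC2 : 0 ≤ blockConst 2 := zero_le_one.trans (one_le_blockConst (α := 2) (by norm_num))
  have hηR : 0 ≤ η * R := mul_nonneg hη.le (Nat.cast_nonneg R)
  have hθ : 0 ≤ 2 ^ ((2 : ℝ) + 1) * blockConst 2 * (η * R) ^ ((3 : ℝ) - 2) :=
    mul_nonneg (mul_nonneg (Real.rpow_nonneg zero_le_two _) hC2) (Real.rpow_nonneg hηR _)
  have hC₁ : 0 ≤ Gg * C₀ * (108 * Real.exp (c * 6) * aD / ℓb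
      + aQ * (4 * (η * R) ^ 3 + 4 * blockConst 2 * (η * R) * (η * ℓb) ^ 2) / η ^ 3) := by positivity
  have hQ0 : ∀ u v : X, 0 ≤ η ^ 3 * (η * dOne (vmaVec (e u - e v))) ^ (-(2 : ℝ)) := fun u v =>
    mul_nonneg (pow_nonneg hη.le 3) (Real.rpow_nonneg (dprimeT_pos hη (e u) (e v)).le _)
  -- the first links against (137), the later links by (143) on the torus
  have hf1 : ∀ (w : TPt 3 Nc) (x : X),
      |g (fun i => (((ℓb * M₀ : ℕ) : ℝ))⁻¹ * (((e x - cz w) i).valMinAbs : ℝ) - t)| ≤ 1 :=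
    fun w x => abs_le.2 ⟨by linarith [g_nonneg (fun i => (((ℓb * M₀ : ℕ) : ℝ))⁻¹ *
      (((e x - cz w) i).valMinAbs : ℝ) - t)], g_le_one _⟩
  have h0 : ∀ w u v, ‖link0 H G w u v‖ ≤ C₀ * ((η ^ 3 * (η * dOne (vmaVec (e u - e v))) ^ (-(2 : ℝ)))
      * Real.exp (-(c * torusDist (β u) (β v)))) := fun w u v =>
    (norm_link0_le (fun w x => g (fun i => (((ℓb * M₀ : ℕ) : ℝ))⁻¹ * (((e x - cz w) i).valMinAbs : ℝ) - t))
      hH hf1 G w u v).trans (h137 w u v)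
  have hR' := fun w u v => eq143_torus (M₀ := M₀) hmodS e he β hβ hη hc.le hR hblk hGg hwin cz H hH A AD AQ hA
    hAD haD hADn hAQ haQ hAQn G hC₀ h137 w u v
  -- the torus geometry of `dimock195`: `d := d(Δ_u,Δ_v)`, `r = 0`, `K = K₁(3, c∕2)`
  have hrad : ∀ u : X, torusDist (β u) (β (ctr (β u))) ≤ 0 := fun u => by rw [hctr, torusDist_self']
  have hK : ∀ b : TPt 3 Nb, ∑ b', Real.exp (-(c / 2) * torusDist (β (ctr b)) (β (ctr b'))) ≤ K₁ 3 (c / 2) := by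
    intro b
    simp_rw [hctr]
    exact RandomWalkTorusDecay.sum_exp_torusDist_le (half_pos hc) b
  have h := norm_chainProd_apply_le (d := fun u v => torusDist (β u) (β v)) (ctr := ctr) (r := 0) (blk := β)
    hθ hc.le hQ0 hQ0 (hconv_shape_torus e he β hη hR hblk) (hconv_shape_torus e he β hη hR hblk)
    (fun u v => torusDist_nonneg _ _) (fun u v => torusDist_comm' _ _) (fun u v t => torusDist_triangle _ _ _)
    hrad hK A H G hC₀ hC₁ hM₀r h0 hR' ω x y
  rw [mul_zero, mul_zero, Real.exp_zero, mul_one, mul_one] at h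
  simpa only [mul_assoc] using h

end Theorem1

end QED3TorusII

end Literature.MathematicalPhysics.QuantumFieldTheory.Dimock2011to13
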